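import Literature.NumberTheory.EllipticCurves.FineSelmerTorsionCoefficientsFiniteProofs
import Literature.NumberTheory.EllipticCurves.IwasawaModuleFinitePadicIntProofs
import HarnessLib

/-!
# Lim–Sujatha 2018, Prop. 3.2 over a NUMBER FIELD (elliptic curves, `p` odd): Coates–Sujatha's
# statement (A) over the cyclotomic `ℤ_p`-extension is an invariant of `E[p]` (proved; no named fact)

`Proofs` file (theorems only). The Literature fact
`LimSujatha2018.prop32_fineSelmerDual_moduleFinite_iff_of_torsionIso` (`FineSelmerCongruentCurves`)
transcribes Prop. 3.2 for elliptic curves over `ℚ`; its module docstring records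
`TODO(general form): number fields F`. The proof assembled by this seat (siblings
`FineSelmerCoefficientMapProofs`, `CyclotomicLocalTorsionDivisibleProofs`,
`FineSelmerTorsionCoefficientsFiniteProofs`, `IwasawaModuleFinitePadicIntProofs`) is written for an
arbitrary number field, so the number-field case of the printed proposition (elliptic curves, `p` odd —
for `p = 2` the source assumes `F` totally imaginary, not treated) is a theorem here:
`prop32_numberField_fineSelmerDual_moduleFinite_iff_of_torsionIso`. Also recorded: the two halves of
Lim–Sujatha's lemma "`Y(E/F^cyc)` finitely generated over `ℤ_p` ⟺ `R(E[p]/F^cyc)` finite"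
(`fineSelmerDual_moduleFinite_iff_finite_fineSelmerInfty_torsion`).

References: [LimSujatha2018] M. F. Lim, R. Sujatha, J. Number Theory 187 (2018) 66–91, §3 (Prop. 3.2
and the lemma before it); [CoatesSujatha2005] §3; [GreenbergLNM1716] §1, §3.
-/

set_option autoImplicit false

noncomputable section

open scoped Classical

namespace Literature.NumberTheory.EllipticCurves.LimSujatha2018

open NumberField Field
open Literature.NumberTheory.EllipticCurves Literature.NumberTheory.EllipticCurves.GreenbergSelmer
  Literature.NumberTheory.GaloisRepresentations

variable {K : Type} [Field K] [NumberField K]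

/-- **Lim–Sujatha's lemma (§3, before Prop. 3.2) for elliptic curves over a number field, `p` odd,
cyclotomic `ℤ_p`-extension**: statement (A) — the Pontryagin dual of `Sel₀(K_∞, E[p^∞])` is finitely
generated over `ℤ_p` (tree's `∃ γ D` form) — holds iff the fine Selmer group of the `p`-TORSION module
`Sel₀(K_∞, E[p])` is finite. [cite: LimSujatha2018, §3 (the lemma before Prop. 3.2: "(A) holds iff R_S(A[π]/F^cyc) is finite")] -/
theorem fineSelmerDual_moduleFinite_iff_finite_fineSelmerInfty_torsion (W : WeierstrassCurve K)
    [W.IsElliptic] {p : ℕ} [Fact p.Prime] (hp : p ≠ 2) (κ : ZpExtension K p) (hκ : κ.IsCyclotomic) :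
    (∃ (γ : absoluteGaloisGroup K) (D : W.FineSelmerDualData κ γ),
        Module.Finite ℤ_[p] (RestrictScalars ℤ_[p] (IwasawaAlgebra p) D.X)) ↔
      (fineSelmerInfty (↥(W.geomTorsion (p : ℤ))) κ :
        Set (subgroupH1 κ.kerSubgroup (W.geomTorsion (p : ℤ)))).Finite := by
  obtain ⟨γ₀, hγ₀⟩ : ∃ γ : absoluteGaloisGroup K, κ.IsTopGenerator γ :=
    κ.surjective (Multiplicative.ofAdd 1)
  rw [IwasawaModuleFinitePadicInt.exists_fineSelmerDualData_moduleFinite_iff_finite_pTorsion W κ hγ₀]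
  exact ⟨FineSelmerCoefficientMap.finite_fineSelmerInfty_torsion_of_finite_pTorsion W κ,
    FineSelmerCoefficientMap.finite_fineSelmerInfty_pTorsion_of_finite_torsion W κ hκ hp⟩

/-- **Lim–Sujatha 2018, Prop. 3.2, for elliptic curves over a number field `K` and an odd prime `p`**:
if `E₁[p] ≅ E₂[p]` as `Γ_K`-modules, then statement (A) for `E₁` over the cyclotomic `ℤ_p`-extension
of `K` holds iff it holds for `E₂` (the fine Selmer group of `E[p]` over `K_∞` depends only on the
Galois module `E[p]`). The case `K = ℚ` is the Literature fact
`prop32_fineSelmerDual_moduleFinite_iff_of_torsionIso`. [cite: LimSujatha2018, §3 Prop. 3.2 (J. Number Theory 187 (2018) 66–91; arXiv:1603.08640 p. 8)] -/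
theorem prop32_numberField_fineSelmerDual_moduleFinite_iff_of_torsionIso
    (W₁ W₂ : WeierstrassCurve K) [W₁.IsElliptic] [W₂.IsElliptic] (p : ℕ) [Fact p.Prime] (hp : p ≠ 2)
    (he : ∃ e : W₁.geomTorsion (p : ℤ) ≃+ W₂.geomTorsion (p : ℤ),
      ∀ (σ : absoluteGaloisGroup K) (P : W₁.geomTorsion (p : ℤ)), e (σ • P) = σ • e P)
    (κ : ZpExtension K p) (hκ : κ.IsCyclotomic) :
    (∃ (γ : absoluteGaloisGroup K) (D : W₁.FineSelmerDualData κ γ),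
        Module.Finite ℤ_[p] (RestrictScalars ℤ_[p] (IwasawaAlgebra p) D.X)) ↔
      ∃ (γ : absoluteGaloisGroup K) (D : W₂.FineSelmerDualData κ γ),
        Module.Finite ℤ_[p] (RestrictScalars ℤ_[p] (IwasawaAlgebra p) D.X) := by
  obtain ⟨e, he⟩ := he
  rw [fineSelmerDual_moduleFinite_iff_finite_fineSelmerInfty_torsion W₁ hp κ hκ,
    fineSelmerDual_moduleFinite_iff_finite_fineSelmerInfty_torsion W₂ hp κ hκ]
  exact FineSelmerCoefficientMap.finite_fineSelmerInfty_iff_of_addEquiv κ e he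

end Literature.NumberTheory.EllipticCurves.LimSujatha2018

end
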